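import Literature.Computability.AlgebraicComplexity.MatMul22mRankFiniteField
import Literature.Computability.AlgebraicComplexity.SmallFormatRankProofs
import HarnessLib

/-!
# The Hopcroft–Kerr count `h(p,n) = ⌈(3pn + max(n,p))/2⌉` for `p × 2` by `2 × n` matrix multiplication

Topic `Literature/Computability/AlgebraicComplexity` (bilinear complexity; small formats). ONE
definition (the printed count, as a natural number) with its arithmetic API, and PROVED bridges to the
tree's upper-bound / exact-value theorems; no named facts.

* **J. E. Hopcroft, L. R. Kerr**, *On minimizing the number of multiplications necessary for matrix
  multiplication*, SIAM J. Appl. Math. **20** (1971) 30–36; preprint = Cornell CS Technical Report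
  TR 69-44 (September 1969, hdl:1813/5902). **Theorem 1** (TR p. 8; journal §2), abstract verbatim:
  «This paper develops an algorithm to multiply a p × 2 matrix by a 2 × n matrix in
  ⌈(3pn + max(n,p))/2⌉ multiplications without use of commutativity. The algorithm minimizes the number
  of multiplications for matrix multiplication without commutativity for the special cases p = 1 or 2,
  n = 1,2,··· and p = 3, n = 3.»  TR pp. 27–28, verbatim: «A detailed case analysis of the 3×2 by 2×4
  case seems to indicate that 19 multiplications are required rather than the 20 of Theorem 1. However,
  we conjecture that 20 are required and the algorithm of Theorem 1 is optimal for all n and p.»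
* `hopcroftKerrCount p n := (3·p·n + max n p + 1) / 2` is that count (`Nat` ceiling of the printed
  half-integer; `two_mul_hopcroftKerrCount_bounds`). It is symmetric in `(p, n)` and evaluates to the
  familiar numbers `h(2,2) = 7`, `h(2,3) = 11`, `h(2,4) = 14`, `h(2,n) = ⌈7n/2⌉`, `h(3,3) = 15`,
  `h(3,4) = 20`, `h(3,5) = 25`, `h(3,n) = 5n` (`n ≥ 3`), `h(4,4) = 26`, `h(4,5) = 33`, `h(5,5) = 40`.
* In the tree's format convention `⟨p,2,n⟩`, `⟨2,n,p⟩`, `⟨n,p,2⟩`, … all have the same rank (Bläser 2013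
  Lemma 5.5 = `tensorRank_matMulTensor_rotate` / `_transpose`); the bridges below are stated for the
  tree's `⟨2,p,n⟩` theorems: `R(⟨2,2,n⟩) ≤ h(2,n)` and `R(⟨2,3,n⟩) ≤ h(3,n)` (`n ≥ 3`) over every
  commutative ring (Hopcroft–Kerr's algorithm as formalised in `MatMulTwoTwoNRankUpper` /
  `MatMulTwoThreeNRankBounds`), `R(⟨2,4,4⟩) ≤ h(4,4)`, `R(⟨2,5,5⟩) ≤ h(5,5)` (catalogue schemes,
  `SmallFormatMatMulRankUpper`); EXACT: `R(⟨2,2,2⟩) = h(2,2)` over every field (Strassen / Winograd 1971)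
  and `R_F(⟨2,2,n⟩) = h(2,n)` for every field with two elements (Hopcroft–Kerr 1971 Thm 5 /
  Alekseev–Nazarov 2019); and the REFUTATION of the general optimality conjecture away from
  characteristic `2`: `R(⟨2,4,5⟩) ≤ 32 < 33 = h(4,5)` whenever `8` is a unit (Novikov et al. 2025 =
  AlphaEvolve, Table 2 «⟨2,4,5⟩: 33 → 32», scheme kernel-checked in `SmallFormatMatMulRankUpper`).
  STATUS of the conjecture over `𝔽₂` (the model of HK's lower bounds, TR p. 15): proved for `p ≤ 2`
  (all `n`) and `(p,n) = (3,3)` in print; open otherwise in print (cell pub-mm22, 2026-08-22, reports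
  `(3,4)` over `𝔽₂` at computer-assisted grade; not a theorem of this tree). This file makes NO claim
  beyond the bridges it proves; the conjecture itself is not vendored (conjectures are not Literature).

## References

* [HopcroftKerr1971] SIAM J. Appl. Math. 20 (1971) 30–36, Theorem 1 (= TR 69-44 Thm 1 p. 8), Thm 5,
  and TR 69-44 pp. 27–28 (the conjecture).
* [AlekseevNazarov2019] the `𝔽₂` lower bound `⌈7n/2⌉` (tree `tensorRank_matMulTensor_22n_card_two`).
* [NovikovEtAl2025] AlphaEvolve, arXiv:2506.13131, Table 2 (`⟨2,4,5⟩`: 32).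
* [Winograd1971] / Strassen 1969: `R(⟨2,2,2⟩) = 7` (tree `tensorRank_matMulTensor_two_eq_seven'`).
-/

namespace Literature.Computability.AlgebraicComplexity

/-- **The Hopcroft–Kerr count** `h(p,n) = ⌈(3pn + max(n,p))/2⌉` — the number of multiplications of
Hopcroft–Kerr's algorithm for a `p × 2` by `2 × n` matrix product without commutativity (as a natural
number: `(3pn + max(n,p) + 1) / 2` with truncated division is the ceiling of the printed half-integer).
[cite: HopcroftKerr1971, Theorem 1] -/
def hopcroftKerrCount (p n : ℕ) : ℕ := (3 * p * n + max n p + 1) / 2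

/-- Unfolding. [cite: HopcroftKerr1971, Theorem 1] -/
theorem hopcroftKerrCount_def (p n : ℕ) : hopcroftKerrCount p n = (3 * p * n + max n p + 1) / 2 := rfl

/-- The count is the CEILING of `(3pn + max(n,p))/2`: `3pn + max ≤ 2h ≤ 3pn + max + 1`.
[cite: HopcroftKerr1971, Theorem 1] -/
theorem two_mul_hopcroftKerrCount_bounds (p n : ℕ) :
    3 * p * n + max n p ≤ 2 * hopcroftKerrCount p n ∧
      2 * hopcroftKerrCount p n ≤ 3 * p * n + max n p + 1 := by
  unfold hopcroftKerrCount; omega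

/-- `h(p,n) = h(n,p)` (the printed expression is symmetric). [cite: HopcroftKerr1971, Theorem 1] -/
theorem hopcroftKerrCount_comm (p n : ℕ) : hopcroftKerrCount p n = hopcroftKerrCount n p := by
  unfold hopcroftKerrCount; rw [max_comm, Nat.mul_right_comm]

/-- `h(1,n) = 2n` (`n ≥ 1`; `= R(⟨1,2,n⟩) = 2n`, trivially optimal). [cite: HopcroftKerr1971, Theorem 1] -/
theorem hopcroftKerrCount_one (n : ℕ) (hn : 1 ≤ n) : hopcroftKerrCount 1 n = 2 * n := by
  unfold hopcroftKerrCount; rw [max_eq_left hn]; omega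

/-- `h(2,n) = ⌈7n/2⌉` (`n ≥ 1`). [cite: HopcroftKerr1971, Theorem 1] -/
theorem hopcroftKerrCount_two (n : ℕ) (hn : 1 ≤ n) : hopcroftKerrCount 2 n = (7 * n + 1) / 2 := by
  unfold hopcroftKerrCount
  rcases Nat.lt_or_ge n 2 with h | h
  · obtain rfl : n = 1 := by omega
    rfl
  · rw [max_eq_left h]; omega

/-- `h(3,n) = 5n` (`n ≥ 3`). [cite: HopcroftKerr1971, Theorem 1] -/
theorem hopcroftKerrCount_three (n : ℕ) (hn : 3 ≤ n) : hopcroftKerrCount 3 n = 5 * n := by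
  unfold hopcroftKerrCount; rw [max_eq_left hn]; omega

/-- The small values: `h(2,2) = 7`, `h(2,3) = 11`, `h(2,4) = 14`, `h(2,5) = 18`, `h(3,3) = 15`,
`h(3,4) = 20`, `h(3,5) = 25`, `h(4,4) = 26`, `h(4,5) = 33`, `h(5,5) = 40`. [cite: HopcroftKerr1971, Theorem 1] -/
theorem hopcroftKerrCount_values :
    hopcroftKerrCount 2 2 = 7 ∧ hopcroftKerrCount 2 3 = 11 ∧ hopcroftKerrCount 2 4 = 14 ∧
    hopcroftKerrCount 2 5 = 18 ∧ hopcroftKerrCount 3 3 = 15 ∧ hopcroftKerrCount 3 4 = 20 ∧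
    hopcroftKerrCount 3 5 = 25 ∧ hopcroftKerrCount 4 4 = 26 ∧ hopcroftKerrCount 4 5 = 33 ∧
    hopcroftKerrCount 5 5 = 40 := by
  decide

/-! ## Bridges to the tree's theorems (Hopcroft–Kerr's algorithm as an upper bound; exact values) -/

section Bridges

/-- **`R(⟨2,2,n⟩) ≤ h(2,n)`** over every commutative ring, `n ≥ 1` (Hopcroft–Kerr's algorithm at
`p = 2`, tree `hopcroftKerr1971_tensorRank_matMulTensor_22n_le`). [cite: HopcroftKerr1971, Theorem 1] -/
theorem tensorRank_matMulTensor_22n_le_hopcroftKerrCount (K : Type*) [CommRing K] (n : ℕ) (hn : 1 ≤ n) :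
    tensorRank (matMulTensor K 2 2 n) ≤ hopcroftKerrCount 2 n := by
  rw [hopcroftKerrCount_two n hn]
  exact hopcroftKerr1971_tensorRank_matMulTensor_22n_le (K := K) n

/-- **`R(⟨2,3,n⟩) ≤ h(3,n)`** over every commutative ring, `n ≥ 3` (Hopcroft–Kerr's algorithm at
`p = 3`, tree `hopcroftKerr1971_tensorRank_matMulTensor_23n_le`). [cite: HopcroftKerr1971, Theorem 1] -/
theorem tensorRank_matMulTensor_23n_le_hopcroftKerrCount (K : Type*) [CommRing K] (n : ℕ) (hn : 3 ≤ n) :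
    tensorRank (matMulTensor K 2 3 n) ≤ hopcroftKerrCount 3 n := by
  rw [hopcroftKerrCount_three n hn]
  exact hopcroftKerr1971_tensorRank_matMulTensor_23n_le K n hn

/-- **`R(⟨2,4,4⟩) ≤ h(4,4) = 26`** over every commutative ring (catalogue scheme, tree
`tensorRank_matMulTensor_244_le`). [cite: HopcroftKerr1971, Theorem 1] -/
theorem tensorRank_matMulTensor_244_le_hopcroftKerrCount (K : Type*) [CommRing K] :
    tensorRank (matMulTensor K 2 4 4) ≤ hopcroftKerrCount 4 4 :=
  (tensorRank_matMulTensor_244_le K).trans (by decide)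

/-- **`R(⟨2,5,5⟩) ≤ h(5,5) = 40`** over every commutative ring (catalogue scheme, tree
`tensorRank_matMulTensor_255_le`). [cite: HopcroftKerr1971, Theorem 1] -/
theorem tensorRank_matMulTensor_255_le_hopcroftKerrCount (K : Type*) [CommRing K] :
    tensorRank (matMulTensor K 2 5 5) ≤ hopcroftKerrCount 5 5 :=
  (tensorRank_matMulTensor_255_le K).trans (by decide)

/-- **Exact at `(2,2)` over every field: `R(⟨2,2,2⟩) = h(2,2) = 7`** (Strassen 1969 / Winograd 1971;
tree `tensorRank_matMulTensor_two_eq_seven'`). [cite: Winograd1971, Theorem] -/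
theorem tensorRank_matMulTensor_222_eq_hopcroftKerrCount (K : Type) [Field K] :
    tensorRank (matMulTensor K 2 2 2) = hopcroftKerrCount 2 2 := by
  rw [tensorRank_matMulTensor_two_eq_seven' K]; decide

/-- **Exact at `p = 2` over every field with two elements: `R_F(⟨2,2,n⟩) = h(2,n) = ⌈7n/2⌉`**
(Hopcroft–Kerr 1971, Thm 5, in their `GF(2)` model; lower bound Alekseev–Nazarov 2019; tree
`tensorRank_matMulTensor_22n_card_two`). [cite: HopcroftKerr1971, Theorem 5] [cite: AlekseevNazarov2019, Theorem (K = 2)] -/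
theorem tensorRank_matMulTensor_22n_eq_hopcroftKerrCount_of_card_two (F : Type) [Field F] [Fintype F]
    (hF : Fintype.card F = 2) (n : ℕ) (hn : 1 ≤ n) :
    tensorRank (matMulTensor F 2 2 n) = hopcroftKerrCount 2 n := by
  rw [hopcroftKerrCount_two n hn]
  exact tensorRank_matMulTensor_22n_card_two F hF n

/-- **The general optimality conjecture fails away from characteristic `2`**: whenever `8` is a unit
in `K` (e.g. `ℚ`, `ℝ`, `ℂ`, `𝔽_p` for odd `p`), `R(⟨2,4,5⟩) ≤ 32 < 33 = h(4,5)` (the AlphaEvolve scheme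
of Novikov et al. 2025, Table 2, kernel-checked in the tree as `tensorRank_matMulTensor_245_le`).
Nothing is asserted in characteristic `2`. [cite: NovikovEtAl2025, Table 2 (⟨2,4,5⟩: 33 → 32)] -/
theorem tensorRank_matMulTensor_245_lt_hopcroftKerrCount (K : Type*) [CommRing K]
    (hD : IsUnit ((8 : ℤ) : K)) : tensorRank (matMulTensor K 2 4 5) < hopcroftKerrCount 4 5 :=
  lt_of_le_of_lt (tensorRank_matMulTensor_245_le K hD) (by decide)

end Bridges

end Literature.Computability.AlgebraicComplexity
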